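import Literature.NumberTheory.EllipticCurves.TianYuanZhang2017.GenusPointDescentDisplays
import Literature.NumberTheory.EllipticCurves.TianYuanZhang2017.GenusDescentEnSide
import Literature.NumberTheory.EllipticCurves.TianYuanZhang2017.GenusDescentDefs
import HarnessLib

/-!
# Tian–Yuan–Zhang, W2 kernel: the twist transfer `A_n′(ℚ) → A(K_n)⁻`, `E_n(ℚ) → A₂(K_n)⁻` ("Twist")

W2 (p2-lead ML-56; p2-monsky-lit GEN 8), file 5/6.  p2-lit-1's display (`GenusPointDescentDisplays`) follows the page:
TYZ's FIXED curve `A : Y² = X³ + 4X` (`curveA`) with the STANDARD Galois action, the minus part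
`A(K_n)⁻ = {α : ᾱ = −α}` (`minusPart n`, [TYZ §3.1, p0011 L33]) and the explicit 2-isogeny `φ_A : A → A₂`
(`curveA.twoIsogenyPointsHom`).  The Mordell–Weil input (GZK, the index `2^ρ`) lives on the tree's `ℚ`-curves
`E_n = congruentNumberCurve n`, `A_n′ = E_n.twoIsogenyCodomain`.  This file builds the bridge, entirely from tree
algebra (Silverman, AEC X.5 Cor. 5.4, via the tree's `untwistEquivAt`): `A_n′ = A^{(−n)}` and
`(1/2;0,0,0)•E_n = A₂^{(−n)}` as EQUATIONS (`Atwo_eq_twist`, `CE_smul`); `Θ_A : A_n′(ℚ) →+ A(K_n)`,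
`Θ_E : E_n(ℚ) →+ A₂(K_n)` (`(X,Y) ↦ (X/θ², Y/θ³)`, `θ = √−n`); PROVED: `Θ_A`, `Θ_E` land in the minus parts,
`Θ_A` is ONTO `A(K_n)⁻` (Galois descent over the quadratic field `K_n`: `exists_ιK_eq`) and injective (torsion-
faithful), the INTERTWINING `φ_A ∘ Θ_A = Θ_E ∘ ψ_ℚ`, and the HALVING of `Θ_E(R)` over `ℍ′_n` (K2: `x(R)` is a
square in `ℍ′_n ⊇ ℚ(i, √p : p ∣ n)` by the tree's descent lemma `exists_squarefree_dvd_sqClass_eq`, and the explicit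
preimage `φ_A(q, wq) = (w², Ȳ)`).  No `def … : Prop`, no sorry.  HONEST FRAMING: consumed by
`UPlusOfGenusPointData` (file 6/6), where U⁺ becomes a theorem MODULO `tyz_genusPointData` + GZK by name.

## References
* Y. Tian, X. Yuan, S.-W. Zhang, Asian J. Math. 21 (2017), arXiv:1411.4728, §1 (p0002 L101–L110), §3.1 (p0011
  L27–L36). [TianYuanZhang2017]
* J. H. Silverman, *The Arithmetic of Elliptic Curves*, 2nd ed., X.5 Cor. 5.4 (quadratic twists), III.4.5.
  [SilvermanAEC2009]
* J. H. Silverman, J. T. Tate, *Rational Points on Elliptic Curves*, §3.5 (descent via 2-isogeny). [SilvermanTate2015]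
-/

noncomputable section

open scoped Classical

namespace Literature.NumberTheory.EllipticCurves.TianYuanZhang2017.W2

open _root_.WeierstrassCurve _root_.WeierstrassCurve.Affine
open Literature.NumberTheory.EllipticCurves
open Literature.NumberTheory.EllipticCurves.TianYuanZhang2017

section GPD

variable {n : ℕ}

/-- `N_A Q = β′Q + Q` (unfolding). [cite: TianYuanZhang2017, §3.1 (chunk p0011 L27–L36, A(K_n)⁻) with §1 (p0002 L101–L110, φ_n : A_n → E_n)] -/
theorem normA_apply (D : GenusPointData n) (Q : APoint D.H) : normA D Q = D.betaPt Q + Q := rfl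

/-- `φ ∘ N_A = N_E ∘ φ` (T4 `map_twoIsogenyPointsHom`). [cite: TianYuanZhang2017, §3.1 (chunk p0011 L27–L36, A(K_n)⁻) with §1 (p0002 L101–L110, φ_n : A_n → E_n)] -/
theorem φH_normA (D : GenusPointData n) (Q : APoint D.H) : φH D (normA D Q) = normE D (φH D Q) := by
  simp only [normA, normE, AddMonoidHom.add_apply, AddMonoidHom.id_apply, map_add, φH,
    map_twoIsogenyPointsHom]

/-- `ker φ_H = {0, τ(1)}`. PROVED (tree `twoIsogenyHom_eq_zero_iff` through the transport). [cite: TianYuanZhang2017, §3.1 (chunk p0011 L27–L36, A(K_n)⁻) with §1 (p0002 L101–L110, φ_n : A_n → E_n)] -/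
theorem φH_eq_zero_iff (D : GenusPointData n) (Q : APoint D.H) :
    φH D Q = 0 ↔ Q = 0 ∨ Q = tauOne := by
  simp only [φH, twoIsogenyPointsHom, AddMonoidHom.coe_comp, AddEquiv.coe_toAddMonoidHom,
    Function.comp_apply, EmbeddingLike.map_eq_zero_iff, twoIsogenyHom_eq_zero_iff]
  rfl

/-! ### THE TWIST TRANSFER (the fixed-`A` model's price, W2-SECONDREAD-1 §D) -/

/-- `conj θ = −θ` (the conjugation of `K_n`, p0011 L33). [cite: TianYuanZhang2017, §3.1 (chunk p0011 L27–L36, A(K_n)⁻) with §1 (p0002 L101–L110, φ_n : A_n → E_n)] -/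
theorem conj_θn : genusFieldConj n (θn n) = -θn n := AdjoinRoot.liftAlgHom_root _ _ _ _

/-- `ι_K` on an affine point: the same coordinates read in `K`. [cite: TianYuanZhang2017, §3.1 (chunk p0011 L27–L36, A(K_n)⁻) with §1 (p0002 L101–L110, φ_n : A_n → E_n)] -/
theorem ιK_some (W : WeierstrassCurve ℚ) (K : Type) [Field K] [Algebra ℚ K] {x y : ℚ}
    (h : W.toAffine.Nonsingular x y) :
    ∃ h', ιK W K (.some x y h) = .some (algebraMap ℚ K x) (algebraMap ℚ K y) h' :=
  ⟨_, rfl⟩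

/-- `ι_K` is injective. [cite: TianYuanZhang2017, §3.1 (chunk p0011 L27–L36, A(K_n)⁻) with §1 (p0002 L101–L110, φ_n : A_n → E_n)] -/
theorem ιK_injective (W : WeierstrassCurve ℚ) (K : Type) [Field K] [Algebra ℚ K] :
    Function.Injective (ιK W K) :=
  Point.map_injective (W' := W) _

/-- `f_* ∘ ι_K = ι_L` for a `ℚ`-algebra map `f : K → L` (`Point.map_baseChange`). [cite: TianYuanZhang2017, §3.1 (chunk p0011 L27–L36, A(K_n)⁻) with §1 (p0002 L101–L110, φ_n : A_n → E_n)] -/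
theorem map_ιK (W : WeierstrassCurve ℚ) {K L : Type} [Field K] [Algebra ℚ K] [Field L] [Algebra ℚ L]
    (f : K →ₐ[ℚ] L) (P : W.toAffine.Point) : Point.map (W' := W) f (ιK W K P) = ιK W L P :=
  Point.map_baseChange (W' := W) f P

/-- `Θ_A` unfolded: `untwist ∘ ι_K ∘ (A_n′ = A^{(−n)})`. [cite: TianYuanZhang2017, §3.1 (chunk p0011 L27–L36, A(K_n)⁻) with §1 (p0002 L101–L110, φ_n : A_n → E_n)] -/
theorem ΘA_apply (hn : n ≠ 0) (P : (Atwo n).toAffine.Point) :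
    ΘA hn P = untwistEquivAt curveA (θn_sq hn) (θn_ne_zero hn)
      (ιK _ (GenusField n) (Affine.Point.congrEquiv (Atwo_eq_twist (n := n)) P)) := rfl

/-- `Θ_E` unfolded: `untwist ∘ ι_K ∘ (E_n ≅ A₂^{(−n)})`. [cite: TianYuanZhang2017, §3.1 (chunk p0011 L27–L36, A(K_n)⁻) with §1 (p0002 L101–L110, φ_n : A_n → E_n)] -/
theorem ΘE_apply (hn : n ≠ 0) (R : (congruentNumberCurve n).toAffine.Point) :
    ΘE hn R = untwistEquivAt curveA.twoIsogenyCodomain (θn_sq hn) (θn_ne_zero hn)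
      (ιK _ (GenusField n) (Affine.Point.congrEquiv (CE_smul (n := n))
        (VariableChange.pointEquiv (congruentNumberCurve n) CE R))) := rfl

/-- (1) `Θ_A` lands in the minus part: `conj ∘ Θ_A = −Θ_A` (`conj θ = −θ`, `map_untwistEquivAt_of_eq_neg`). [cite: TianYuanZhang2017, §3.1 (chunk p0011 L27–L36, A(K_n)⁻) with §1 (p0002 L101–L110, φ_n : A_n → E_n)] -/
theorem map_conj_ΘA (hn : n ≠ 0) (P : (Atwo n).toAffine.Point) :
    Point.map (W' := curveA) (genusFieldConj n) (ΘA hn P) = -ΘA hn P := by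
  rw [ΘA_apply, map_untwistEquivAt_of_eq_neg curveA (θn_sq hn) (θn_ne_zero hn) (θn_sq hn)
    (θn_ne_zero hn) (genusFieldConj n) conj_θn, map_ιK]

/-- (4) `Θ_E` lands in the minus part. [cite: TianYuanZhang2017, §3.1 (chunk p0011 L27–L36, A(K_n)⁻) with §1 (p0002 L101–L110, φ_n : A_n → E_n)] -/
theorem map_conj_ΘE (hn : n ≠ 0) (R : (congruentNumberCurve n).toAffine.Point) :
    Point.map (W' := curveA.twoIsogenyCodomain) (genusFieldConj n) (ΘE hn R) = -ΘE hn R := by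
  rw [ΘE_apply, map_untwistEquivAt_of_eq_neg curveA.twoIsogenyCodomain (θn_sq hn) (θn_ne_zero hn)
    (θn_sq hn) (θn_ne_zero hn) (genusFieldConj n) conj_θn, map_ιK]

/-- (3) `Θ_A` is injective, hence torsion-faithful. [cite: TianYuanZhang2017, §3.1 (chunk p0011 L27–L36, A(K_n)⁻) with §1 (p0002 L101–L110, φ_n : A_n → E_n)] -/
theorem ΘA_injective (hn : n ≠ 0) : Function.Injective (ΘA hn) := fun _ _ h =>
  (Affine.Point.congrEquiv (Atwo_eq_twist (n := n))).injective
    (ιK_injective _ _ ((untwistEquivAt curveA (θn_sq hn) (θn_ne_zero hn)).injective h))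

/-- `Θ_A` is torsion-faithful: `Θ_A P` torsion ⇒ `P` torsion. [cite: TianYuanZhang2017, §3.1 (chunk p0011 L27–L36, A(K_n)⁻) with §1 (p0002 L101–L110, φ_n : A_n → E_n)] -/
theorem isOfFinAddOrder_of_ΘA (hn : n ≠ 0) (P : (Atwo n).toAffine.Point)
    (hP : IsOfFinAddOrder (ΘA hn P)) : IsOfFinAddOrder P :=
  ((ΘA_injective hn).isOfFinAddOrder_iff).mp hP

/-! #### Descent of `conj`-fixed points from `K_n` to `ℚ` -/

/-- Every element of `K_n = ℚ[X]/(X² + n)` is `a + bθ` with `a, b ∈ ℚ` (division by the monic `X² + n`). [cite: TianYuanZhang2017, §3.1 (chunk p0011 L27–L36, A(K_n)⁻) with §1 (p0002 L101–L110, φ_n : A_n → E_n)] -/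
theorem exists_add_mul_θn (z : GenusField n) :
    ∃ a b : ℚ, z = algebraMap ℚ _ a + algebraMap ℚ _ b * θn n := by
  induction z using AdjoinRoot.induction_on with
  | ih p =>
    have hm := monic_genusFieldPoly n
    have hmk : AdjoinRoot.mk (genusFieldPoly n) p = AdjoinRoot.mk _ (p %ₘ genusFieldPoly n) := by
      rw [AdjoinRoot.mk_eq_mk]
      refine ⟨p /ₘ genusFieldPoly n, ?_⟩
      have := Polynomial.modByMonic_add_div p (genusFieldPoly n)
      linear_combination (-1 : Polynomial ℚ) * this
    have hdeg : (p %ₘ genusFieldPoly n).natDegree ≤ 1 := by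
      have h := Polynomial.natDegree_modByMonic_lt p hm (fun h1 => by
        have := natDegree_genusFieldPoly n; rw [h1, Polynomial.natDegree_one] at this; omega)
      rw [natDegree_genusFieldPoly] at h
      omega
    refine ⟨(p %ₘ genusFieldPoly n).coeff 0, (p %ₘ genusFieldPoly n).coeff 1, ?_⟩
    rw [hmk]
    conv_lhs => rw [Polynomial.eq_X_add_C_of_natDegree_le_one hdeg]
    have hof : AdjoinRoot.of (genusFieldPoly n) = algebraMap ℚ (GenusField n) := Subsingleton.elim _ _
    rw [map_add, map_mul, AdjoinRoot.mk_C, AdjoinRoot.mk_C, AdjoinRoot.mk_X, hof]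
    ring

/-- An element of `K_n` fixed by `conj` is rational (`a + bθ ↦ a − bθ`). [cite: TianYuanZhang2017, §3.1 (chunk p0011 L27–L36, A(K_n)⁻) with §1 (p0002 L101–L110, φ_n : A_n → E_n)] -/
theorem exists_rat_of_conj_eq (hn : n ≠ 0) {z : GenusField n} (hz : genusFieldConj n z = z) :
    ∃ q : ℚ, algebraMap ℚ _ q = z := by
  obtain ⟨a, b, rfl⟩ := exists_add_mul_θn z
  rw [map_add, map_mul, AlgHom.commutes, AlgHom.commutes, conj_θn] at hz
  have h2 : (2 : GenusField n) * (algebraMap ℚ _ b * θn n) = 0 := by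
    linear_combination (-1 : GenusField n) * hz
  have hb : algebraMap ℚ (GenusField n) b = 0 :=
    (mul_eq_zero.mp ((mul_eq_zero.mp h2).resolve_left two_ne_zero)).resolve_right (θn_ne_zero hn)
  exact ⟨a, by rw [hb, zero_mul, add_zero]⟩

/-- A `K_n`-point of a `ℚ`-curve fixed by `conj` is a `ℚ`-point. [cite: TianYuanZhang2017, §3.1 (chunk p0011 L27–L36, A(K_n)⁻) with §1 (p0002 L101–L110, φ_n : A_n → E_n)] -/
theorem exists_ιK_eq (hn : n ≠ 0) (W : WeierstrassCurve ℚ)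
    (X : (W.baseChange (GenusField n)).toAffine.Point)
    (hX : Point.map (W' := W) (genusFieldConj n) X = X) : ∃ P : W.toAffine.Point, ιK W _ P = X := by
  rcases X with _ | ⟨x, y, h⟩
  · exact ⟨0, map_zero _⟩
  · rw [Point.map_some] at hX
    obtain ⟨hx, hy⟩ := Point.some.inj hX
    obtain ⟨qx, rfl⟩ := exists_rat_of_conj_eq hn hx
    obtain ⟨qy, rfl⟩ := exists_rat_of_conj_eq hn hy
    have h' := (Affine.baseChange_nonsingular (W := W) (Algebra.ofId ℚ (GenusField n)).injective qx qy).mp h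
    exact ⟨.some qx qy h', rfl⟩

/-- (2) `Θ_A` is ONTO the minus part (Galois descent over the quadratic field `K_n`). [cite: TianYuanZhang2017, §3.1 (chunk p0011 L27–L36, A(K_n)⁻) with §1 (p0002 L101–L110, φ_n : A_n → E_n)] -/
theorem exists_ΘA_eq (hn : n ≠ 0) (γ : APoint (GenusField n)) (hγ : γ ∈ minusPart n) :
    ∃ P, ΘA hn P = γ := by
  have hγ' : Point.map (W' := curveA) (genusFieldConj n) γ = -γ := hγ
  set X := (untwistEquivAt curveA (θn_sq hn) (θn_ne_zero hn)).symm γ with hX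
  have hfix : Point.map (W' := curveA.quadraticTwist (-(n : ℚ))) (genusFieldConj n) X = X := by
    rw [hX, map_untwistEquivAt_symm_of_eq_neg curveA (θn_sq hn) (θn_ne_zero hn) (θn_sq hn)
      (θn_ne_zero hn) (genusFieldConj n) conj_θn, hγ', map_neg, neg_neg]
  obtain ⟨P', hP'⟩ := exists_ιK_eq hn _ X hfix
  refine ⟨(Affine.Point.congrEquiv (Atwo_eq_twist (n := n))).symm P', ?_⟩
  rw [ΘA_apply, AddEquiv.apply_symm_apply, hP', hX, AddEquiv.apply_symm_apply]

/-! #### Coordinates -/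

/-- The scaling's new abscissa: `x ↦ 4x`. [cite: TianYuanZhang2017, §3.1 (chunk p0011 L27–L36, A(K_n)⁻) with §1 (p0002 L101–L110, φ_n : A_n → E_n)] -/
theorem CE_toX (x : ℚ) : CE.toX x = 4 * x := by
  norm_num [VariableChange.toX_def, CE]

/-- The scaling's new ordinate: `y ↦ 8y`. [cite: TianYuanZhang2017, §3.1 (chunk p0011 L27–L36, A(K_n)⁻) with §1 (p0002 L101–L110, φ_n : A_n → E_n)] -/
theorem CE_toY (x y : ℚ) : CE.toY x y = 8 * y := by
  norm_num [VariableChange.toY_def, CE]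

/-- `a₂(A_n′) = 0`. [cite: TianYuanZhang2017, §3.1 (chunk p0011 L27–L36, A(K_n)⁻) with §1 (p0002 L101–L110, φ_n : A_n → E_n)] -/
theorem Atwo_a₂ : (congruentNumberCurve n).twoIsogenyCodomain.a₂ = 0 := by
  simp [twoIsogenyCodomain, congruentNumberCurve]

/-- `a₄(A_n′) = 4n²`. [cite: TianYuanZhang2017, §3.1 (chunk p0011 L27–L36, A(K_n)⁻) with §1 (p0002 L101–L110, φ_n : A_n → E_n)] -/
theorem Atwo_a₄ : (congruentNumberCurve n).twoIsogenyCodomain.a₄ = 4 * (n : ℚ) ^ 2 := by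
  simp [twoIsogenyCodomain, congruentNumberCurve]

/-- `Θ_A(X, Y) = (X/θ², Y/θ³)` on an affine point. [cite: TianYuanZhang2017, §3.1 (chunk p0011 L27–L36, A(K_n)⁻) with §1 (p0002 L101–L110, φ_n : A_n → E_n)] -/
theorem ΘA_some (hn : n ≠ 0) {X Y : ℚ} (h : (Atwo n).toAffine.Nonsingular X Y) :
    ∃ h', ΘA hn (.some X Y h) = .some ((θn n ^ 2)⁻¹ * algebraMap ℚ (GenusField n) X)
      ((θn n ^ 3)⁻¹ * algebraMap ℚ (GenusField n) Y) h' := by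
  rw [ΘA_apply, Affine.Point.congrEquiv_some]
  obtain ⟨h₂, e₂⟩ := ιK_some (curveA.quadraticTwist (-(n : ℚ))) (GenusField n)
    ((Atwo_eq_twist (n := n)) ▸ h)
  rw [e₂]
  exact untwistEquivAt_some curveA (θn_sq hn) (θn_ne_zero hn) h₂

/-- `Θ_E(x, y) = (4x/θ², 8y/θ³)` on an affine point. [cite: TianYuanZhang2017, §3.1 (chunk p0011 L27–L36, A(K_n)⁻) with §1 (p0002 L101–L110, φ_n : A_n → E_n)] -/
theorem ΘE_some (hn : n ≠ 0) {x y : ℚ} (h : (congruentNumberCurve n).toAffine.Nonsingular x y) :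
    ∃ h', ΘE hn (.some x y h) = .some ((θn n ^ 2)⁻¹ * algebraMap ℚ (GenusField n) (4 * x))
      ((θn n ^ 3)⁻¹ * algebraMap ℚ (GenusField n) (8 * y)) h' := by
  rw [ΘE_apply, VariableChange.pointEquiv_some, Affine.Point.congrEquiv_some]
  obtain ⟨h₂, e₂⟩ := ιK_some (curveA.twoIsogenyCodomain.quadraticTwist (-(n : ℚ))) (GenusField n)
    ((CE_smul (n := n)) ▸ (VariableChange.nonsingular_iff _ CE x y).mpr h)
  rw [e₂]
  obtain ⟨h₃, e₃⟩ := untwistEquivAt_some curveA.twoIsogenyCodomain (θn_sq hn) (θn_ne_zero hn) h₂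
  rw [e₃]
  have h₄ := h₃
  rw [CE_toX, CE_toY] at h₄
  refine ⟨h₄, ?_⟩
  rw [Point.some.injEq, CE_toX, CE_toY]
  exact ⟨rfl, rfl⟩

/-- (5) THE INTERTWINING `φ_A ∘ Θ_A = Θ_E ∘ ψ_ℚ` (coordinates: both sides are
`(−(X² + 4n²)/(nX), −Y(X² − 4n²)/(nθX²))`). [cite: TianYuanZhang2017, §3.1 (chunk p0011 L27–L36, A(K_n)⁻) with §1 (p0002 L101–L110, φ_n : A_n → E_n)] -/
theorem twist_intertwine (hn : n ≠ 0) [(congruentNumberCurve n).IsElliptic] (P : (Atwo n).toAffine.Point) :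
    curveA.twoIsogenyPointsHom (GenusField n) (ΘA hn P) = ΘE hn (ψQ n P) := by
  rcases P with _ | ⟨X, Y, h⟩
  · rw [← Point.zero_def, map_zero, map_zero, map_zero, map_zero]
  · by_cases hX : X = 0
    · have hY : Y = 0 := by
        have he := (Affine.equation_iff _ _).mp h.left
        rw [hX, Atwo_a₂, Atwo_a₄] at he
        simpa [twoIsogenyCodomain, congruentNumberCurve] using he
      subst hX; subst hY
      obtain ⟨h₁, e₁⟩ := ΘA_some hn h
      rw [e₁, twoIsogenyPointsHom_some_of_eq_zero curveA h₁ (by rw [map_zero, mul_zero]),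
        twoIsogenyDualHomOf_apply, twoIsogenyDualFun_some_of_eq_zero _ h rfl, map_zero]
    · obtain ⟨h₁, e₁⟩ := ΘA_some hn h
      have hθ := θn_ne_zero hn
      have hXK' : algebraMap ℚ (GenusField n) X ≠ 0 := by
        rwa [map_ne_zero_iff _ (algebraMap ℚ (GenusField n)).injective]
      have hXK : (θn n ^ 2)⁻¹ * algebraMap ℚ (GenusField n) X ≠ 0 :=
        mul_ne_zero (inv_ne_zero (pow_ne_zero _ hθ)) hXK'
      obtain ⟨h₂, e₂⟩ := twoIsogenyPointsHom_some curveA h₁ hXK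
      rw [e₁, e₂, twoIsogenyDualHomOf_apply, twoIsogenyDualFun_some _ h hX]
      obtain ⟨h₃, e₃⟩ := ΘE_some hn ((congruentNumberCurve n).nonsingular_twoIsogenyDual h.left hX)
      rw [e₃, Point.some.injEq]
      obtain ⟨-, h2', -, h4', -⟩ := curveA_baseChange_a (H := GenusField n)
      have hnK : (n : GenusField n) ≠ 0 := Nat.cast_ne_zero.mpr hn
      have hθ2inv : (θn n ^ 2)⁻¹ = -((n : GenusField n))⁻¹ := by
        rw [θn_sq hn, map_neg, map_natCast]
        exact inv_eq_of_mul_eq_one_left (by rw [neg_mul_neg, inv_mul_cancel₀ hnK])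
      constructor
      · rw [twoIsogenyX, h2', h4', twoIsogenyDualX, twoIsogenyX, Atwo_a₂, Atwo_a₄]
        simp only [map_mul, map_div₀, map_add, map_pow, map_ofNat, map_natCast, zero_mul, add_zero]
        rw [hθ2inv]
        field_simp
      · rw [twoIsogenyY, h4', twoIsogenyDualY, twoIsogenyY, Atwo_a₄]
        simp only [map_mul, map_div₀, map_sub, map_pow, map_ofNat, map_natCast]
        rw [hθ2inv]
        field_simp

/-! #### Halving on `A → A₂` over `ℍ′_n` -/

/-- The coefficients of `A₂ = (Y² = X³ − 16X)` over `H`. [cite: TianYuanZhang2017, §3.1 (chunk p0011 L27–L36, A(K_n)⁻) with §1 (p0002 L101–L110, φ_n : A_n → E_n)] -/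
theorem curveA₂_baseChange_a {H : Type} [Field H] [Algebra ℚ H] :
    (curveA.twoIsogenyCodomain.baseChange H).a₁ = 0 ∧ (curveA.twoIsogenyCodomain.baseChange H).a₂ = 0 ∧
      (curveA.twoIsogenyCodomain.baseChange H).a₃ = 0 ∧ (curveA.twoIsogenyCodomain.baseChange H).a₄ = -16 ∧
      (curveA.twoIsogenyCodomain.baseChange H).a₆ = 0 := by
  simp [curveA, twoIsogenyCodomain, WeierstrassCurve.baseChange]; norm_num

/-- HALVING, generic case: a point `(X̄, Ȳ)` of `A₂(ℍ′_n)` with `X̄ = w² ≠ 0` is `φ_A(q, wq)` with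
`q = (w³ + Ȳ)/(2w)` (Silverman–Tate's descent criterion `X̄ ∈ H^{×2}`, made explicit). [cite: TianYuanZhang2017, §3.1 (chunk p0011 L27–L36, A(K_n)⁻) with §1 (p0002 L101–L110, φ_n : A_n → E_n)] -/
theorem exists_φH_eq_some_of_sq (D : GenusPointData n) {X Y w : D.H}
    (h : (curveA.twoIsogenyCodomain.baseChange D.H).toAffine.Nonsingular X Y) (hw : w ≠ 0)
    (hX : X = w ^ 2) : ∃ Q : APoint D.H, φH D Q = .some X Y h := by
  obtain ⟨-, h2, -, h4, -⟩ := curveA_baseChange_a (H := D.H)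
  obtain ⟨k1, k2, k3, k4, k6⟩ := curveA₂_baseChange_a (H := D.H)
  have hE : Y ^ 2 = w ^ 6 - 16 * w ^ 2 := by
    have := (Affine.equation_iff _ _).mp h.left
    rw [k1, k2, k3, k4, k6, hX] at this
    linear_combination this
  have h2w : (2 : D.H) * w ≠ 0 := mul_ne_zero two_ne_zero hw
  set q : D.H := (w ^ 3 + Y) / (2 * w) with hq
  have hmul : q * (2 * w) = w ^ 3 + Y := by rw [hq, div_mul_cancel₀ _ h2w]
  have hquad : q ^ 2 - w ^ 2 * q + 4 = 0 := by
    have h4w : (4 * w ^ 2) * (q ^ 2 - w ^ 2 * q + 4) = 0 := by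
      linear_combination (2 * w * q - w ^ 3 + Y) * hmul + hE
    exact (mul_eq_zero.mp h4w).resolve_left (mul_ne_zero (by norm_num) (pow_ne_zero 2 hw))
  have hq0 : q ≠ 0 := by
    intro h0; rw [h0] at hquad; norm_num at hquad
  have hQns : (curveA.baseChange D.H).toAffine.Nonsingular q (w * q) := by
    rw [curveA_nonsingular_iff]; linear_combination (-q) * hquad
  refine ⟨.some q (w * q) hQns, ?_⟩
  obtain ⟨h', e⟩ := twoIsogenyPointsHom_some curveA hQns hq0
  rw [e, Point.some.injEq]
  constructor
  · rw [twoIsogenyX, h2, h4, hX, div_eq_iff hq0]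
    linear_combination hquad
  · rw [twoIsogenyY, h4, div_eq_iff (pow_ne_zero 2 hq0)]
    linear_combination q ^ 2 * hmul + (-(w * q)) * hquad

/-- HALVING at `(0, 0) ∈ A₂`: `φ_A(2i, 0) = (0, 0)` (`−16 = (4i)²`). [cite: TianYuanZhang2017, §3.1 (chunk p0011 L27–L36, A(K_n)⁻) with §1 (p0002 L101–L110, φ_n : A_n → E_n)] -/
theorem exists_φH_eq_some_of_eq_zero (D : GenusPointData n) {X Y : D.H}
    (h : (curveA.twoIsogenyCodomain.baseChange D.H).toAffine.Nonsingular X Y) (hX : X = 0) :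
    ∃ Q : APoint D.H, φH D Q = .some X Y h := by
  obtain ⟨-, h2, -, h4, -⟩ := curveA_baseChange_a (H := D.H)
  obtain ⟨k1, k2, k3, k4, k6⟩ := curveA₂_baseChange_a (H := D.H)
  have him := D.im_sq
  have hY : Y = 0 := by
    have := (Affine.equation_iff _ _).mp h.left
    rw [k1, k2, k3, k4, k6, hX] at this
    have hY2 : Y ^ 2 = 0 := by linear_combination this
    exact pow_eq_zero_iff (n := 2) (by norm_num) |>.mp hY2
  have hi0 : (2 : D.H) * D.im ≠ 0 := mul_ne_zero two_ne_zero (fun h0 => by rw [h0] at him; norm_num at him)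
  have hQns : (curveA.baseChange D.H).toAffine.Nonsingular (2 * D.im) 0 := by
    rw [curveA_nonsingular_iff]; linear_combination (-8 * D.im) * him
  refine ⟨.some (2 * D.im) 0 hQns, ?_⟩
  obtain ⟨h', e⟩ := twoIsogenyPointsHom_some curveA hQns hi0
  rw [e, Point.some.injEq]
  constructor
  · rw [twoIsogenyX, h2, h4, hX, div_eq_iff hi0]
    linear_combination 4 * him
  · rw [twoIsogenyY, hY, zero_mul, zero_div]

/-- K2: the abscissa of a rational point of `E_n` is a SQUARE in `ℍ′_n ⊇ ℚ(i, √p : p ∣ n)`: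
`x = d·□` with `d` square-free, `d ∣ n²` (the tree's descent lemma `exists_squarefree_dvd_sqClass_eq`),
so `d ∣ n` and `±d` are squares in `ℍ′_n` (`√−d, i ∈ ℍ′_n`). [cite: TianYuanZhang2017, §3.1 (chunk p0011 L27–L36, A(K_n)⁻) with §1 (p0002 L101–L110, φ_n : A_n → E_n)] -/
theorem exists_sq_eq_x (D : GenusPointData n) (hsq : Squarefree n) {x y : ℚ}
    (h : (congruentNumberCurve n).toAffine.Nonsingular x y) (hx : x ≠ 0) :
    ∃ t : D.H, t ≠ 0 ∧ algebraMap ℚ D.H x = t ^ 2 := by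
  have hn0 : (n : ℤ) ≠ 0 := by exact_mod_cast hsq.ne_zero
  -- the tree's descent lemma, on the literal model `⟨0, a, 0, b, 0⟩` with `a = 0`, `b = −n²`
  have hW : congruentNumberCurve n =
      (⟨0, ((0 : ℤ) : ℚ), 0, ((-((n : ℤ) ^ 2) : ℤ) : ℚ), 0⟩ : WeierstrassCurve ℚ) := by
    simp [congruentNumberCurve]
  have hab : (-((n : ℤ) ^ 2)) * ((0 : ℤ) ^ 2 - 4 * (-((n : ℤ) ^ 2))) ≠ 0 := by
    rw [show ((0 : ℤ) ^ 2 - 4 * (-((n : ℤ) ^ 2))) = 4 * (n : ℤ) ^ 2 by ring]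
    exact mul_ne_zero (neg_ne_zero.mpr (pow_ne_zero 2 hn0)) (mul_ne_zero (by norm_num) (pow_ne_zero 2 hn0))
  have hc : sqClass x ∈ Set.range
      (⟨0, ((0 : ℤ) : ℚ), 0, ((-((n : ℤ) ^ 2) : ℤ) : ℚ), 0⟩ : WeierstrassCurve ℚ).xSqClass := by
    refine ⟨Affine.Point.congrEquiv hW (.some x y h), ?_⟩
    rw [Affine.Point.congrEquiv_some, xSqClass_some_of_ne_zero _ hx]
  obtain ⟨d, hdsq, hdvd, hclass⟩ := exists_squarefree_dvd_sqClass_eq hab hc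
  have hd0 : (d : ℚ) ≠ 0 := by exact_mod_cast hdsq.ne_zero
  -- `d·x` is a square in `ℚ`
  obtain ⟨u, hu⟩ : ∃ u : ℚ, (d : ℚ) * x = u ^ 2 := by
    rw [← sqClass_eq_one_iff (mul_ne_zero hd0 hx), sqClass_mul hd0 hx, hclass, Affine.SqUnits.mul_self]
  -- `d ∣ n`, so `m = |d| ∈ n.divisors` and `±m` are squares in `ℍ′_n`
  have hdn : d ∣ (n : ℤ) := (hdsq.dvd_pow_iff_dvd two_ne_zero).mp (dvd_neg.mp hdvd)
  have hm : d.natAbs ∈ n.divisors :=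
    Nat.mem_divisors.mpr ⟨by simpa using Int.natAbs_dvd_natAbs.mpr hdn, hsq.ne_zero⟩
  have hsm := D.sqrtNeg_sq d.natAbs hm
  have him := D.im_sq
  -- a square root `s` of `d` in `H`
  obtain ⟨s, hs⟩ : ∃ s : D.H, s ^ 2 = (d : D.H) := by
    rcases Int.natAbs_eq d with hd | hd
    · refine ⟨D.sqrtNeg d.natAbs * D.im, ?_⟩
      conv_rhs => rw [hd, Int.cast_natCast]
      rw [mul_pow, hsm, him]
      ring
    · refine ⟨D.sqrtNeg d.natAbs, ?_⟩
      conv_rhs => rw [hd, Int.cast_neg, Int.cast_natCast]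
      exact hsm
  have hs0 : s ≠ 0 := by
    intro h0; rw [h0, zero_pow two_ne_zero] at hs
    exact (Int.cast_ne_zero.mpr hdsq.ne_zero) hs.symm
  refine ⟨algebraMap ℚ D.H u / s, div_ne_zero (fun hu0 => ?_) hs0, ?_⟩
  · rw [map_eq_zero_iff _ (algebraMap ℚ D.H).injective] at hu0
    rw [hu0, zero_pow two_ne_zero, mul_eq_zero] at hu
    exact hu.elim hd0 hx
  · have hux : algebraMap ℚ D.H x * (d : D.H) = algebraMap ℚ D.H u ^ 2 := by
      rw [← map_pow, ← hu, map_mul, map_intCast, mul_comm]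
    rw [div_pow, ← hux, hs, mul_div_assoc, div_self (Int.cast_ne_zero.mpr hdsq.ne_zero), mul_one]

/-- (6) THE HALVING of `ι Θ_E(R)` over `ℍ′_n`: `X(ι Θ_E R) = 4x(R)/(√−n)² = (2t/√−n)²` with `x(R) = t²`
(K2), so `ι Θ_E(R) ∈ φ_A(A(ℍ′_n))`. [cite: TianYuanZhang2017, §3.1 (chunk p0011 L27–L36, A(K_n)⁻) with §1 (p0002 L101–L110, φ_n : A_n → E_n)] -/
theorem twist_halving (hsq : Squarefree n) (hn : n ∈ n.divisors) [(congruentNumberCurve n).IsElliptic]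
    (D : GenusPointData n) (R : (congruentNumberCurve n).toAffine.Point) :
    ∃ Q₁ : APoint D.H, φH D Q₁ =
      Point.map (W' := curveA.twoIsogenyCodomain) (D.embK n hn) (ΘE hsq.ne_zero R) := by
  have hn0 := hsq.ne_zero
  rcases R with _ | ⟨x, y, h⟩
  · exact ⟨0, by rw [← Point.zero_def, map_zero, map_zero, map_zero]⟩
  · obtain ⟨h₃, e₃⟩ := ΘE_some hn0 h
    rw [e₃, Point.map_some]
    have hθ : D.embK n hn (θn n) = D.sqrtNeg n := AdjoinRoot.liftAlgHom_root _ _ _ _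
    have hs : D.sqrtNeg n ^ 2 = -(n : D.H) := D.sqrtNeg_sq n hn
    by_cases hx : x = 0
    · apply exists_φH_eq_some_of_eq_zero
      rw [hx, mul_zero, map_zero, mul_zero, map_zero]
    · obtain ⟨t, ht0, htx⟩ := exists_sq_eq_x D hsq h hx
      have hsn0 : D.sqrtNeg n ≠ 0 := fun h0 => by
        rw [h0, zero_pow two_ne_zero, zero_eq_neg, Nat.cast_eq_zero] at hs; exact hn0 hs
      refine exists_φH_eq_some_of_sq D _ (w := 2 * t / D.sqrtNeg n)
        (div_ne_zero (mul_ne_zero two_ne_zero ht0) hsn0) ?_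
      rw [map_mul, map_inv₀, map_pow, hθ, AlgHom.commutes, map_mul, map_ofNat, htx, div_pow, hs]
      field_simp
      ring

/-- **The twist transfer** (assembled; was `stub_twist`): `Θ_A : A_n′(ℚ) → A(K_n)` ONTO the minus part,
`Θ_E : E_n(ℚ) → A₂(K_n)` INTO the minus part, torsion-faithful, INTERTWINING the named dual
`ψ_ℚ : A_n′(ℚ) → E_n(ℚ)` with `φ_A`, and the HALVING of `Θ_E(R)` over any `ℍ′_n`. [cite: TianYuanZhang2017, §3.1 (chunk p0011 L27–L36, A(K_n)⁻) with §1 (p0002 L101–L110, φ_n : A_n → E_n)] -/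
theorem stub_twist (hsq : Squarefree n) (hn : n ∈ n.divisors) [(congruentNumberCurve n).IsElliptic] :
    ∃ (ΘA : (congruentNumberCurve n).twoIsogenyCodomain.toAffine.Point →+ APoint (GenusField n))
      (ΘE : (congruentNumberCurve n).toAffine.Point →+ A2Point (GenusField n)),
      (∀ P, ΘA P ∈ minusPart n) ∧ (∀ γ ∈ minusPart n, ∃ P, ΘA P = γ) ∧
      (∀ P, IsOfFinAddOrder (ΘA P) → IsOfFinAddOrder P) ∧
      (∀ R, Point.map (W' := curveA.twoIsogenyCodomain) (genusFieldConj n) (ΘE R) = -ΘE R) ∧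
      (∀ P, curveA.twoIsogenyPointsHom (GenusField n) (ΘA P) = ΘE (ψQ n P)) ∧
      (∀ (D : GenusPointData n) (R : (congruentNumberCurve n).toAffine.Point),
        ∃ Q₁ : APoint D.H, φH D Q₁ = Point.map (W' := curveA.twoIsogenyCodomain) (D.embK n hn) (ΘE R)) :=
  ⟨ΘA hsq.ne_zero, ΘE hsq.ne_zero, map_conj_ΘA hsq.ne_zero, exists_ΘA_eq hsq.ne_zero,
    isOfFinAddOrder_of_ΘA hsq.ne_zero, map_conj_ΘE hsq.ne_zero, twist_intertwine hsq.ne_zero,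
    twist_halving hsq hn⟩

end GPD

end Literature.NumberTheory.EllipticCurves.TianYuanZhang2017.W2
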